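import Literature.Probability.FitznerVanDerHofstad2017.MeanFieldD11AppDFull
import Literature.Probability.FitznerVanDerHofstad2017.NobleKSpaceRewriteF
import HarnessLib

/-!
# Mean-field behaviour at `d = 11` on the kernel App.-D line, V: Step 1 of App. D DISCHARGED on the `F` side — the residual hypothesis is (D.32) for the constructed `R_F`

CITATION HEADER (PLACEMENT v2). Part of the certified REPRODUCTION of R. Fitzner, R. van der Hofstad, *Mean-field behavior for
nearest-neighbor percolation in d > 10*, EJP 22 (2017) no. 43 [FvdH17] and *Generalized approach to the non-backtracking lace
expansion*, PTRF 169 (2017) 1041–1119 [NoBLE17]; build `lace`, seat lean2 (gen 13).  ADDITIVE re-base of `MeanFieldD11AppD`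
(module I, untouched) through `nobleSimplifiedFormAt_percolation₃` of `NobleKSpaceRewriteF` (module 3b of the App.-D kernel
reconstruction: `c_F`, `α_F`, `R_F := F − c_F δ − (α_F/2d)·NN` CONSTRUCTED and the lower enclosure (D.3) `α̲_F(i) ≤ α_F` PROVED from
Assumption 4.3 under the decidable sign condition (N4) `0 ≤ α̲_F(i)`).  No record file, no published numeral, no certificate of
record is changed; nothing here is a cited fact; no `def … : Prop`.

WHAT CHANGES RELATIVE TO MODULE I.  In `meanField_d11_appD` the `F`-side hypothesis is the COMBINED (D.3)+(D.32) inequality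
`(α̲_F(i) − β_Δ(i))(1 − D̂(k)) ≤ F̂_p(0) − F̂_p(k)` about the whole function `F_p`.  Here it is replaced by the STRICTLY SMALLER residual
that App. D Steps 3–5 are about — (D.32) for the constructed remainder `R_F = F − F^α` ALONE:
`(F₃)  ∀ k, −β_Δ(i)·(1 − D̂(k)) ≤ R̂_F(0) − R̂_F(k)`  (`nobleFRem (percolationNobleSplit 11 p …)`, β-table `nobleBetaOfInputs 11 inputsI/O`
as wired by the notebooks, DIVERGENCE D29), the Step-1 part `α̲_F ≤ α_F` being supplied by the kernel (`noble_alphaF_lower`).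
REFEREE W50.2 (v50, informational: "(N4) `0 ≤ α̲_F(i)` must be `norm_num`-discharged at `inputsI`/`inputsO` before any d = 11
sentence is re-based through `nobleSimplifiedFormAt_percolation₃`") is DISCHARGED here: `n4_inputsI`, `n4_inputsO` (`norm_num` through
`BetaMap.betaAfLow` at the published records; the values are `α̲_F(i) ≈ 1.0447`, `α̲_F(o) ≈ 1.0495`, cf. `MeanFieldD11Cert` `Bi.αFlow`,
`Bo.αFlow`).

WHAT IS PROVED.  `n4_inputsI/O`; `nobleSimplifiedFormAt_d11_o₃ / _i₃` (Prop. 4.5(ii) at `d = 11` from (S2a) + (F₃)); the oracle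
binders `nobleImprovementInputsAt_d11_step1`, `nobleInitialInputsAt_d11_step1`; the sentences `meanField_d11_step1`
(`TriangleCondition 11 ∧ PercolationContinuity 11 ∧ BetaEqOneBoundedRatio 11`), `percolationContinuity_d11_step1`,
`meanField_full_d11_step1 : … → MeanField 11` — from (S2a) Assumption 4.3 with the published constants `inputsI` at `p_I` /
`inputsO` on the window under `f ≤ Γ`, (S2b) the Prop. 2.2 weighted-diagram bounds `bi`/`bo`, and (F₃).  Certificate, bootstrap
and exponents exactly as in modules I/III (`meanField_d11_inputs`, `meanField_of_triangle`).  Standard axioms.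
EPISTEMIC STATUS.  (S2a), (S2b), (F₃) are typed statements about percolation on `ℤ^11`, ANALYTIC, NOT CITABLE as typed.  (F₃) is
the output of App. D Steps 3–5 ((D.15)–(D.32)) for `R_F`; the kernel reconstruction of those steps is in progress in other modules
(`NobleWeightedConvolution`, module 3c-A, landed; its Part C records that the Step-4 bookkeeping yields the constant
`BetaMap.betaRfDeltaCorr`, DIVERGENCE D65, in place of the transcribed display) — when it lands, (F₃) is discharged from (S2a) with
the `βΔ` slot it delivers, and the certificate is re-evaluated at that table; THIS module changes no constant and re-chooses no `γ`.
The sentence is about `d = 11` only.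

[cite: FitznerVanDerHofstad2017, Thm 1.1 / Cor. 1.3 (d = 11), §2.5–§2.7]
[cite: FitznerVanDerHofstad2016NoBLE, Prop. 4.5 (p. 1088); §4.1.3 (4.15)–(4.17) (pp. 1082–1083); App. D Step 1 (D.1)–(D.5) (pp. 1110–1111), Step 5 (D.30)–(D.32) (p. 1117)]
-/

namespace Literature.Probability.FitznerVanDerHofstad2017

open _root_.MeasureTheory _root_.Filter _root_.Topology Literature.Probability.LatticeModels
open Literature.Barriers.CriticalPhenomena Literature.Probability.Percolation
open scoped BigOperators

namespace D11

/-! ## 1. (N4) at the published records (REFEREE W50.2) -/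

/-- **(N4) at `inputsI`: `0 ≤ α̲_F(inputsI)`** (`norm_num` through (D.3) `betaAfLow`). [cite: FitznerVanDerHofstad2016NoBLE, App. D Step 1 (D.3) (p. 1111)] -/
theorem n4_inputsI : 0 ≤ (BetaMap.nobleBetaOfInputs ((11 : ℕ) : ℝ) inputsI).αFlow := by
  norm_num [BetaMap.nobleBetaOfInputs, BetaMap.betaAfLow, inputsI]

/-- **(N4) at `inputsO`: `0 ≤ α̲_F(inputsO)`**. [cite: FitznerVanDerHofstad2016NoBLE, App. D Step 1 (D.3) (p. 1111)] -/
theorem n4_inputsO : 0 ≤ (BetaMap.nobleBetaOfInputs ((11 : ℕ) : ℝ) inputsO).αFlow := by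
  norm_num [BetaMap.nobleBetaOfInputs, BetaMap.betaAfLow, inputsO]

/-! ## 2. Prop. 4.5(ii) at `d = 11` with the residual hypothesis (D.32) for `R_F` -/

/-- **[NoBLE17] Prop. 4.5(ii) at `d = 11` on the window, Step 1 discharged**: Assumption 4.3 at `p` for the percolation split with
`inputsO` (S2a) and (F₃) = (D.32) for the constructed `R_F` give the simplified NoBLE form with `β(inputsO)`; (N1′)(N2)(N3)(N4), the
regime, the NoBLE equations, Assumption 4.1, the Φ-side and the F-side Step 1 are kernel theorems.
[cite: FitznerVanDerHofstad2016NoBLE, Prop. 4.5 (p. 1088); App. D (D.1)–(D.5), (D.9)–(D.14), (D.32)] [cite: FitznerVanDerHofstad2017, §2.5 (d = 11)] -/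
theorem nobleSimplifiedFormAt_d11_o₃ {p : unitInterval} (hp : p < criticalProbI 11) (hp0 : 0 < (p : ℝ))
    (h43 : NobleAssumption43At 11 p (percolationNobleSplit 11 p two_le_eleven hp) inputsO)
    (hRF : ∀ k ∈ cube 11,
      -((BetaMap.nobleBetaOfInputs ((11 : ℕ) : ℝ) inputsO).βΔ * (1 - Dhat 11 k)) ≤
        cosFT (nobleFRem (percolationNobleSplit 11 p two_le_eleven hp)) 0 -
          cosFT (nobleFRem (percolationNobleSplit 11 p two_le_eleven hp)) k) :
    NobleSimplifiedFormAt 11 p (BetaMap.nobleBetaOfInputs ((11 : ℕ) : ℝ) inputsO) :=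
  nobleSimplifiedFormAt_percolation₃ two_le_eleven hp hp0 inputsO_WF
    (percolationNobleEquationAt_of_summable two_le_eleven hp hp0 h43.xiAbs.2.1 fun ι => (h43.xiIotaAbs ι).2.1)
    h43 n1_inputsO n2_inputsO n3_inputsO n4_inputsO hRF

/-- **[NoBLE17] Prop. 4.5(ii) at `d = 11`, initial point `p_I = 1/21`, Step 1 discharged** (as `nobleSimplifiedFormAt_d11_o₃`, constants
`inputsI`). [cite: FitznerVanDerHofstad2016NoBLE, Prop. 4.5 (p. 1088); Assumption 4.3 (z = z_I); App. D] [cite: FitznerVanDerHofstad2017, §2.4–§2.5] -/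
theorem nobleSimplifiedFormAt_d11_i₃
    (h43 : NobleAssumption43At 11 (nbwThresholdI 11)
      (percolationNobleSplit 11 (nbwThresholdI 11) two_le_eleven (nbwThresholdI_lt_criticalProbI two_le_eleven)) inputsI)
    (hRF : ∀ k ∈ cube 11,
      -((BetaMap.nobleBetaOfInputs ((11 : ℕ) : ℝ) inputsI).βΔ * (1 - Dhat 11 k)) ≤
        cosFT (nobleFRem (percolationNobleSplit 11 (nbwThresholdI 11) two_le_eleven (nbwThresholdI_lt_criticalProbI two_le_eleven))) 0 -
          cosFT (nobleFRem (percolationNobleSplit 11 (nbwThresholdI 11) two_le_eleven (nbwThresholdI_lt_criticalProbI two_le_eleven))) k) :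
    NobleSimplifiedFormAt 11 (nbwThresholdI 11) (BetaMap.nobleBetaOfInputs ((11 : ℕ) : ℝ) inputsI) :=
  have hp := nbwThresholdI_lt_criticalProbI two_le_eleven
  have hp0 : 0 < ((nbwThresholdI 11 : unitInterval) : ℝ) := nbwThresholdI_pos (by norm_num)
  nobleSimplifiedFormAt_percolation₃ two_le_eleven hp hp0 inputsI_WF
    (percolationNobleEquationAt_of_summable two_le_eleven hp hp0 h43.xiAbs.2.1 fun ι => (h43.xiIotaAbs ι).2.1)
    h43 n1_inputsI n2_inputsI n3_inputsI n4_inputsI hRF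

/-! ## 3. The `d = 11` sentence with Step 1 discharged -/

/-- **The improvement-step oracle binder at `d = 11`, `F`-side Step 1 discharged**: for every `p ∈ (p_I, p_c)` under `f ≤ Γ`,
(S2a) Assumption 4.3 with `inputsO`, (F₃) (D.32) for `R_F` at `p`, (S2b) `bo`. [cite: FitznerVanDerHofstad2016NoBLE, Prop. 4.5, Prop. 2.11] [cite: FitznerVanDerHofstad2017, Prop. 2.2; §2.5] -/
theorem nobleImprovementInputsAt_d11_step1
    (hS : ∀ (p : unitInterval) (hp : p ∈ Set.Ioo (nbwThresholdI 11) (criticalProbI 11)),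
      (∀ j, Literature.Barriers.CriticalPhenomena.nobleF 11 cMuC cWeightsC j p ≤ GammaC j) →
        NobleAssumption43At 11 p (percolationNobleSplit 11 p two_le_eleven hp.2) inputsO ∧
        (∀ k ∈ cube 11,
          -((BetaMap.nobleBetaOfInputs ((11 : ℕ) : ℝ) inputsO).βΔ * (1 - Dhat 11 k)) ≤
            cosFT (nobleFRem (percolationNobleSplit 11 p two_le_eleven hp.2)) 0 -
              cosFT (nobleFRem (percolationNobleSplit 11 p two_le_eleven hp.2)) k) ∧
        NobleWeightedDiagramBoundAt 11 p bo) :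
    NobleImprovementInputsAt 11 cMuC cWeightsC GammaC (BetaMap.nobleBetaOfInputs 11 inputsO) bo := by
  intro p hp hΓ
  obtain ⟨h43, hRF, hW⟩ := hS p hp hΓ
  have hp0 : 0 < (p : ℝ) :=
    lt_trans (nbwThresholdI_pos (by norm_num)) (show ((nbwThresholdI 11 : unitInterval) : ℝ) < p by exact_mod_cast hp.1)
  have hS' := nobleSimplifiedFormAt_d11_o₃ hp.2 hp0 h43 hRF
  simp only [Nat.cast_ofNat] at hS'
  exact ⟨hS', hW⟩

/-- **The initial-step oracle binder at `d = 11`, `F`-side Step 1 discharged.** [cite: FitznerVanDerHofstad2016NoBLE, Prop. 4.5; Assumption 4.3 (z = z_I); Prop. 2.11] [cite: FitznerVanDerHofstad2017, Prop. 2.2; §2.4–§2.5] -/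
theorem nobleInitialInputsAt_d11_step1
    (hI43 : NobleAssumption43At 11 (nbwThresholdI 11)
      (percolationNobleSplit 11 (nbwThresholdI 11) two_le_eleven (nbwThresholdI_lt_criticalProbI two_le_eleven)) inputsI)
    (hIRF : ∀ k ∈ cube 11,
      -((BetaMap.nobleBetaOfInputs ((11 : ℕ) : ℝ) inputsI).βΔ * (1 - Dhat 11 k)) ≤
        cosFT (nobleFRem (percolationNobleSplit 11 (nbwThresholdI 11) two_le_eleven (nbwThresholdI_lt_criticalProbI two_le_eleven))) 0 -
          cosFT (nobleFRem (percolationNobleSplit 11 (nbwThresholdI 11) two_le_eleven (nbwThresholdI_lt_criticalProbI two_le_eleven))) k)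
    (hIW : NobleWeightedDiagramBoundAt 11 (nbwThresholdI 11) bi) :
    NobleInitialInputsAt 11 (BetaMap.nobleBetaOfInputs 11 inputsI) bi := by
  have hS := nobleSimplifiedFormAt_d11_i₃ hI43 hIRF
  simp only [Nat.cast_ofNat] at hS
  exact ⟨hS, hIW⟩

/-- **Mean-field behaviour at `d = 11` on the kernel App.-D line with Step 1 of App. D discharged on BOTH sides.**  REMAINING
HYPOTHESES (ANALYTIC, NOT CITABLE as typed; no named fact): (S2a) Assumption 4.3 for the percolation split with the published
constants — `inputsI` at `p_I`, `inputsO` on `(p_I, p_c)` under `f ≤ Γ`; (S2b) [FvdH17] Prop. 2.2's weighted-diagram bounds `bi`, `bo`;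
(F₃) App. D (D.32) for the CONSTRUCTED remainder `R_F = F − c_F δ − (α_F/2d)·NN`: `−β_Δ(i)(1 − D̂(k)) ≤ R̂_F(0) − R̂_F(k)` at `p_I` and
on the window.  Conclusion: triangle condition, `θ(p_c) = 0`, `β = 1` (bounded ratio) on `ℤ^11`.
[cite: FitznerVanDerHofstad2017, Thm 1.1 / Cor. 1.3 (d = 11: numerical verification re-run with certified arithmetic)]
[cite: FitznerVanDerHofstad2016NoBLE, Thm 2.10, Prop. 2.11, Prop. 4.5, App. D (D.3) proved / (D.32) displayed] -/
theorem meanField_d11_step1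
    (hI43 : NobleAssumption43At 11 (nbwThresholdI 11)
      (percolationNobleSplit 11 (nbwThresholdI 11) two_le_eleven (nbwThresholdI_lt_criticalProbI two_le_eleven)) inputsI)
    (hIRF : ∀ k ∈ cube 11,
      -((BetaMap.nobleBetaOfInputs ((11 : ℕ) : ℝ) inputsI).βΔ * (1 - Dhat 11 k)) ≤
        cosFT (nobleFRem (percolationNobleSplit 11 (nbwThresholdI 11) two_le_eleven (nbwThresholdI_lt_criticalProbI two_le_eleven))) 0 -
          cosFT (nobleFRem (percolationNobleSplit 11 (nbwThresholdI 11) two_le_eleven (nbwThresholdI_lt_criticalProbI two_le_eleven))) k)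
    (hIW : NobleWeightedDiagramBoundAt 11 (nbwThresholdI 11) bi)
    (hS : ∀ (p : unitInterval) (hp : p ∈ Set.Ioo (nbwThresholdI 11) (criticalProbI 11)),
      (∀ j, Literature.Barriers.CriticalPhenomena.nobleF 11 cMuC cWeightsC j p ≤ GammaC j) →
        NobleAssumption43At 11 p (percolationNobleSplit 11 p two_le_eleven hp.2) inputsO ∧
        (∀ k ∈ cube 11,
          -((BetaMap.nobleBetaOfInputs ((11 : ℕ) : ℝ) inputsO).βΔ * (1 - Dhat 11 k)) ≤
            cosFT (nobleFRem (percolationNobleSplit 11 p two_le_eleven hp.2)) 0 -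
              cosFT (nobleFRem (percolationNobleSplit 11 p two_le_eleven hp.2)) k) ∧
        NobleWeightedDiagramBoundAt 11 p bo) :
    TriangleCondition 11 ∧ PercolationContinuity 11 ∧ BetaEqOneBoundedRatio 11 :=
  meanField_d11_inputs (nobleInitialInputsAt_d11_step1 hI43 hIRF hIW) (nobleImprovementInputsAt_d11_step1 hS)

/-- `θ(p_c) = 0` on `ℤ^11`, Step 1 discharged (hypotheses as in `meanField_d11_step1`). [cite: FitznerVanDerHofstad2017, Cor. 1.3 (d = 11)] -/
theorem percolationContinuity_d11_step1
    (hI43 : NobleAssumption43At 11 (nbwThresholdI 11)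
      (percolationNobleSplit 11 (nbwThresholdI 11) two_le_eleven (nbwThresholdI_lt_criticalProbI two_le_eleven)) inputsI)
    (hIRF : ∀ k ∈ cube 11,
      -((BetaMap.nobleBetaOfInputs ((11 : ℕ) : ℝ) inputsI).βΔ * (1 - Dhat 11 k)) ≤
        cosFT (nobleFRem (percolationNobleSplit 11 (nbwThresholdI 11) two_le_eleven (nbwThresholdI_lt_criticalProbI two_le_eleven))) 0 -
          cosFT (nobleFRem (percolationNobleSplit 11 (nbwThresholdI 11) two_le_eleven (nbwThresholdI_lt_criticalProbI two_le_eleven))) k)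
    (hIW : NobleWeightedDiagramBoundAt 11 (nbwThresholdI 11) bi)
    (hS : ∀ (p : unitInterval) (hp : p ∈ Set.Ioo (nbwThresholdI 11) (criticalProbI 11)),
      (∀ j, Literature.Barriers.CriticalPhenomena.nobleF 11 cMuC cWeightsC j p ≤ GammaC j) →
        NobleAssumption43At 11 p (percolationNobleSplit 11 p two_le_eleven hp.2) inputsO ∧
        (∀ k ∈ cube 11,
          -((BetaMap.nobleBetaOfInputs ((11 : ℕ) : ℝ) inputsO).βΔ * (1 - Dhat 11 k)) ≤
            cosFT (nobleFRem (percolationNobleSplit 11 p two_le_eleven hp.2)) 0 -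
              cosFT (nobleFRem (percolationNobleSplit 11 p two_le_eleven hp.2)) k) ∧
        NobleWeightedDiagramBoundAt 11 p bo) :
    PercolationContinuity 11 :=
  (meanField_d11_step1 hI43 hIRF hIW hS).2.1

/-- **[FvdH17] Cor. 1.3 at `d = 11` in full (`MeanField 11`), Step 1 of App. D discharged on both sides** (hypotheses as in
`meanField_d11_step1`; exponents by `meanField_of_triangle`). [cite: FitznerVanDerHofstad2017, Cor. 1.3 (d = 11), EJP p. 6] -/
theorem meanField_full_d11_step1
    (hI43 : NobleAssumption43At 11 (nbwThresholdI 11)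
      (percolationNobleSplit 11 (nbwThresholdI 11) two_le_eleven (nbwThresholdI_lt_criticalProbI two_le_eleven)) inputsI)
    (hIRF : ∀ k ∈ cube 11,
      -((BetaMap.nobleBetaOfInputs ((11 : ℕ) : ℝ) inputsI).βΔ * (1 - Dhat 11 k)) ≤
        cosFT (nobleFRem (percolationNobleSplit 11 (nbwThresholdI 11) two_le_eleven (nbwThresholdI_lt_criticalProbI two_le_eleven))) 0 -
          cosFT (nobleFRem (percolationNobleSplit 11 (nbwThresholdI 11) two_le_eleven (nbwThresholdI_lt_criticalProbI two_le_eleven))) k)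
    (hIW : NobleWeightedDiagramBoundAt 11 (nbwThresholdI 11) bi)
    (hS : ∀ (p : unitInterval) (hp : p ∈ Set.Ioo (nbwThresholdI 11) (criticalProbI 11)),
      (∀ j, Literature.Barriers.CriticalPhenomena.nobleF 11 cMuC cWeightsC j p ≤ GammaC j) →
        NobleAssumption43At 11 p (percolationNobleSplit 11 p two_le_eleven hp.2) inputsO ∧
        (∀ k ∈ cube 11,
          -((BetaMap.nobleBetaOfInputs ((11 : ℕ) : ℝ) inputsO).βΔ * (1 - Dhat 11 k)) ≤
            cosFT (nobleFRem (percolationNobleSplit 11 p two_le_eleven hp.2)) 0 -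
              cosFT (nobleFRem (percolationNobleSplit 11 p two_le_eleven hp.2)) k) ∧
        NobleWeightedDiagramBoundAt 11 p bo) :
    MeanField 11 :=
  meanField_of_triangle (by norm_num) (meanField_d11_step1 hI43 hIRF hIW hS).1

end D11

end Literature.Probability.FitznerVanDerHofstad2017
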